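import Summits.ResolutionOfSingularities.KangarooAtlas.MizutaniFrobeniusGenerization
import Summits.ResolutionOfSingularities.KangarooAtlas.MizutaniExponentBound
import HarnessLib

/-!
# `exponent B(𝔭) ≤ e` iff `B(𝔭)` is the scheme of a `q`-linear point (Oda 1983-II Cor. 2.3, point-intrinsically)

Cell `pub-rosobs`, Mizutani enclosure (seat mizutani-encloser-1, gen 8).  AI-written; *AI review is weaker than
expert review*; NOT a resolution-of-singularities theorem (summit relevance C).

T. Oda, Publ. RIMS 19 (1983), Cor. 2.3 (p. 1171): «`exponent(B) ≤ e` iff the corresponding `V` is defined over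
`F^{−e}(k)`»; Thm. 3.1 (p. 1173): `B = Φ^{(1)}(L_0, φ)` for a linear `φ`, «of exponent `≤ e` iff `φ` can be taken over
`F^{−e}(k)`».  A `q`-LINEAR POINT of `ℙ^n_k` (`q = p^e`) is an ideal `{f : f^{(F^e)} ∈ 𝔩}` where `𝔩 = (Σ g_i X_i : g ∈ N)`
is generated by linear forms (`N ⊆ k^{n+1}` a subspace) — the generic point of the preimage of the `k`-rational linear
space `V(𝔩)` under the `k`-linear Frobenius `x ↦ x^q`; the `k^{1/q}`-rational points `[c^{1/q}]` are the case
`dim V(𝔩) = 1`, and `frobGen k p 𝔭 e` (`MizutaniFrobeniusGenerization`) is the case `N = V_e(𝔭)`.  This file proves: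

* `cdim_add_finrank_pointForms` — `cdim_j(𝔮) + dim_k V_j(𝔮) = n + 1` for every ideal (rank–nullity for
  `g ↦ Σ g_i ξ_i^{p^j}`);
* `exists_orth_family`, `finrank_ker_mulVecLin_of_linearIndependent` — linear algebra of `N^⊥`;
* **`exponentLE_comap_span_linForm`** — EVERY `q`-linear point has exponent `≤ e`: for
  `𝔮 = (span (linForm '' N)).comap (map F^e)`, `cdim_j(𝔮) = n + 1 − dim N` for all `j ≥ e` (`V_e(𝔮) ⊇ N`, and
  `V_{e+m}(𝔮) ⊆ (F^m N^⊥)^⊥` by evaluating at the `k`-points of `V(𝔩)`), then `exponentLE_of_cdim_eq`;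
  hence `exponentLE_frobGen`, `exponent_frobGen_le` (the `q`-linear generization of ANY point has exponent `≤ e`);
* **`exponent_le_iff_bIdeal_frobGen_eq`** — for a point `𝔭`: `exponent B(𝔭) ≤ e ↔ U_+(𝔮_e(𝔭))S = U_+(𝔭)S`, and
  **`exponent_le_iff_exists_qLinear`** — `exponent B(𝔭) ≤ e ↔` `B(𝔭)` is the Hironaka scheme of some `q`-linear point
  (Oda's Cor. 2.3 in the tree's vocabulary, both directions).

## References

* T. Oda, *Hironaka's additive group scheme, II*, Publ. RIMS Kyoto Univ. 19 (1983) 1163–1179, Cor. 2.3 (p. 1171),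
  Thm. 3.1 (p. 1173). [Oda1983HironakaGroupSchemeII]
* H. Mizutani, *Hironaka's additive group schemes*, Nagoya Math. J. 52 (1973) 85–95, §1 (*), (c), (d), Thm. 1.3.
  [Mizutani1973HironakaGroupSchemes]
-/

noncomputable section

open MvPolynomial Literature.AlgebraicGeometry.Resolution Literature.AlgebraicGeometry.Resolution.HironakaScheme
  Literature.RingTheory.MvPolynomial

namespace Summit.ResolutionOfSingularities.KangarooAtlas.Mizutani

universe u

/-! ## Linear algebra in `k^{n+1}` -/

section LinAlg

variable (k : Type u) [Field k] {n : ℕ}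

/-- For a `k`-independent family `μ_1, …, μ_d ∈ k^{n+1}`: `dim_k {g : Σ_i μ_{li} g_i = 0 ∀ l} = n + 1 − d`. [folklore] -/
theorem finrank_ker_mulVecLin_of_linearIndependent {d : ℕ} (μ : Fin d → Fin (n + 1) → k)
    (hμ : LinearIndependent k μ) :
    Module.finrank k (LinearMap.ker (Matrix.of μ).mulVecLin) = n + 1 - d := by
  have hrank : Module.finrank k (LinearMap.range (Matrix.of μ).mulVecLin) = d := by
    change (Matrix.of μ).rank = d
    rw [Matrix.rank_eq_finrank_span_row]
    have hrow : Set.range (Matrix.of μ).row = Set.range μ := rfl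
    rw [hrow, finrank_span_eq_card hμ, Fintype.card_fin]
  have hrn := LinearMap.finrank_range_add_finrank_ker (Matrix.of μ).mulVecLin
  rw [hrank, Module.finrank_fintype_fun_eq_card, Fintype.card_fin] at hrn
  omega

/-- Membership in that kernel. [folklore] -/
theorem mem_ker_mulVecLin_iff {d : ℕ} (μ : Fin d → Fin (n + 1) → k) (g : Fin (n + 1) → k) :
    g ∈ LinearMap.ker (Matrix.of μ).mulVecLin ↔ ∀ l, ∑ i, μ l i * g i = 0 := by
  rw [LinearMap.mem_ker, Matrix.mulVecLin_apply, funext_iff]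
  refine forall_congr' fun l => ?_
  rw [Matrix.mulVec, Pi.zero_apply]
  rfl

/-- **A basis of `N^⊥`**: for a subspace `N ⊆ k^{n+1}` there is a `k`-independent family `λ_1, …, λ_d`, `d + dim N = n + 1`,
orthogonal to `N` for the dot product. [folklore] -/
theorem exists_orth_family (N : Submodule k (Fin (n + 1) → k)) :
    ∃ (d : ℕ) (lam : Fin d → Fin (n + 1) → k), LinearIndependent k lam ∧ d + Module.finrank k N = n + 1 ∧
      ∀ g ∈ N, ∀ l, ∑ i, g i * lam l i = 0 := by
  -- rows: a basis of `N`; `N^⊥` is the kernel of the corresponding matrix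
  set r := Module.finrank k N with hr
  let b := Module.finBasis k N
  let B : Fin r → Fin (n + 1) → k := fun s => (b s : Fin (n + 1) → k)
  have hB : LinearIndependent k B := b.linearIndependent.map' N.subtype (Submodule.ker_subtype N)
  set K := LinearMap.ker (Matrix.of B).mulVecLin with hK
  have hKdim : Module.finrank k K = n + 1 - r := finrank_ker_mulVecLin_of_linearIndependent k B hB
  set d := Module.finrank k K with hd
  let c := Module.finBasis k K
  refine ⟨d, fun l => (c l : Fin (n + 1) → k), c.linearIndependent.map' K.subtype (Submodule.ker_subtype K), ?_, ?_⟩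
  · have : r ≤ n + 1 := by
      have := Submodule.finrank_le N
      rw [Module.finrank_fintype_fun_eq_card, Fintype.card_fin] at this
      exact this
    omega
  · intro g hg l
    -- the functional `g ↦ Σ g_i λ_{li}` kills the basis vectors `b s`, hence `N`
    have hcl : ∀ s, ∑ i, B s i * (c l : Fin (n + 1) → k) i = 0 := fun s =>
      (mem_ker_mulVecLin_iff k B _).mp (c l).2 s
    have hrepr := b.linearCombination_repr ⟨g, hg⟩
    have hg' : g = ∑ s, (b.repr ⟨g, hg⟩ s) • B s := by
      have := congrArg (fun x : N => (x : Fin (n + 1) → k)) hrepr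
      simp only [Finsupp.linearCombination_apply, Finsupp.sum_fintype, Submodule.coe_sum, Submodule.coe_smul,
        zero_smul, implies_true] at this
      exact this.symm
    rw [hg']
    simp only [Finset.sum_apply, Pi.smul_apply, smul_eq_mul, Finset.sum_mul, mul_assoc]
    rw [Finset.sum_comm]
    refine Finset.sum_eq_zero fun s _ => ?_
    rw [← Finset.mul_sum, hcl s, mul_zero]

end LinAlg

/-! ## `cdim` by rank–nullity; `q`-linear points -/

section QLinear

variable (k : Type u) [Field k] (p : ℕ) [hp : Fact p.Prime] [CharP k p] {n : ℕ}

omit hp [CharP k p] in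
/-- **`cdim_j(𝔮) + dim_k V_j(𝔮) = n + 1`** for every ideal `𝔮`: `V_j(𝔮) = {g : Σ g_i X_i^{p^j} ∈ 𝔮}` (`pointForms`) is the
kernel of `g ↦ Σ g_i ξ_i^{p^j}`, whose image is `span_k{ξ_i^{p^j}}`. [folklore] -/
theorem cdim_add_finrank_pointForms (𝔮 : Ideal (MvPolynomial (Fin (n + 1)) k)) (j : ℕ) :
    cdim k p 𝔮 j + Module.finrank k (pointForms k p 𝔮 j) = n + 1 := by
  set Φ := Fintype.linearCombination k (fun i => xi k 𝔮 i ^ p ^ j) with hΦ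
  have hrange : LinearMap.range Φ = powSpan k p 𝔮 j := by
    rw [hΦ, Fintype.range_linearCombination]
    rfl
  have hker : LinearMap.ker Φ = pointForms k p 𝔮 j := by
    ext g
    rw [LinearMap.mem_ker, mem_pointForms_iff, ← Ideal.Quotient.eq_zero_iff_mem, mk_addForm_eq_linearCombination]
  have hrn := LinearMap.finrank_range_add_finrank_ker Φ
  rw [hrange, hker, Module.finrank_fintype_fun_eq_card, Fintype.card_fin] at hrn
  exact hrn

omit hp [CharP k p] in
/-- Evaluating an additive form: `(Σ h_i X_i^{p^j})(v) = Σ h_i v_i^{p^j}`. [folklore] -/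
theorem eval_addForm (v : Fin (n + 1) → k) (j : ℕ) (h : Fin (n + 1) → k) :
    eval v (addForm k p j h) = ∑ i, h i * v i ^ p ^ j := by
  unfold addForm
  rw [map_sum]
  exact Finset.sum_congr rfl fun i _ => by rw [map_mul, eval_C, map_pow, eval_X]

variable (N : Submodule k (Fin (n + 1) → k)) (e : ℕ)

/-- **EVERY `q`-LINEAR POINT HAS EXPONENT `≤ e`**: for a subspace `N ⊆ k^{n+1}` of linear forms and
`𝔮 = {f : f^{(F^e)} ∈ (Σ g_i X_i : g ∈ N)}`, the dimensions `cdim_j(𝔮)` equal `n + 1 − dim N` for all `j ≥ e`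
(`V_e(𝔮) ⊇ N`; `V_{e+m}(𝔮) ⊆ (F^m N^⊥)^⊥` by evaluation at the `k`-points of the linear space), so `ExponentLE k p 𝔮 e`
(`exponentLE_of_cdim_eq`).  Oda's «`φ` over `F^{−e}(k)` ⇒ exponent `≤ e`» for `φ` of every rank (the rank-one case is
`exponentLE_ratPoint`). [cite: Oda1983HironakaGroupSchemeII, Cor. 2.3 (p. 1171) and Thm. 3.1 (p. 1173)] -/
theorem exponentLE_comap_span_linForm :
    ExponentLE k p ((Ideal.span (linForm '' (N : Set (Fin (n + 1) → k)))).comap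
      (MvPolynomial.map (iterateFrobenius k p e))) e := by
  set 𝔩 := Ideal.span (linForm '' (N : Set (Fin (n + 1) → k))) with h𝔩
  set 𝔮 := 𝔩.comap (MvPolynomial.map (iterateFrobenius k p e)) with h𝔮
  haveI : 𝔩.IsPrime := isPrime_span_linForm N
  haveI : 𝔮.IsPrime := Ideal.comap_isPrime _ _
  obtain ⟨d, lam, hlam, hdN, horth⟩ := exists_orth_family k N
  -- (1) `N ⊆ V_e(𝔮)`: `(Σ g_i X_i^q)^{(F^e)} = (Σ g_i X_i)^q ∈ 𝔩`
  have hlow : N ≤ pointForms k p 𝔮 e := by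
    intro g hg
    rw [mem_pointForms_iff, h𝔮, Ideal.mem_comap, map_iterateFrobenius_addForm]
    have hpow : addForm k p e (frobVec k p e g) = linForm g ^ p ^ e := by
      rw [linForm_eq_addForm_zero k p, addForm_pow_pow, Nat.zero_add]
    rw [hpow]
    have hgen : linForm g ∈ 𝔩 := Ideal.subset_span ⟨g, hg, rfl⟩
    exact Ideal.pow_mem_of_mem 𝔩 hgen _ (Nat.pos_of_ne_zero (pow_ne_zero _ hp.out.ne_zero))
  -- (2) `V_{e+m}(𝔮) ⊆ {g : Σ g_i λ_{li}^{p^m} = 0 ∀ l}`: evaluate at the `k`-point `λ_l` of `V(𝔩)`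
  have heval : ∀ l, ∀ f ∈ 𝔩, eval (lam l) f = 0 := by
    intro l
    have hle : 𝔩 ≤ RingHom.ker (eval (lam l) : MvPolynomial (Fin (n + 1)) k →+* k) := by
      rw [h𝔩, Ideal.span_le]
      rintro _ ⟨g, hg, rfl⟩
      rw [SetLike.mem_coe, RingHom.mem_ker, linForm_eq_addForm_zero k p, eval_addForm]
      simp only [pow_zero, pow_one]
      exact horth g hg l
    intro f hf
    exact hle hf
  have hup : ∀ m, pointForms k p 𝔮 (e + m) ≤
      LinearMap.ker (Matrix.of (fun l => frobVec k p m (lam l))).mulVecLin := by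
    intro m g hg
    rw [mem_ker_mulVecLin_iff]
    intro l
    rw [mem_pointForms_iff, h𝔮, Ideal.mem_comap, map_iterateFrobenius_addForm] at hg
    have h0 := heval l _ hg
    rw [eval_addForm] at h0
    -- `Σ g_i^{p^e} λ_{li}^{p^{e+m}} = (Σ λ_{li}^{p^m} g_i)^{p^e}`
    have hsum : (∑ i, frobVec k p m (lam l) i * g i) ^ p ^ e = ∑ i, frobVec k p e g i * lam l i ^ p ^ (e + m) := by
      rw [sum_pow_char_pow]
      refine Finset.sum_congr rfl fun i _ => ?_
      unfold frobVec
      rw [mul_pow, ← pow_mul, ← pow_add, add_comm m e, mul_comm]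
    rw [← hsum] at h0
    exact pow_eq_zero_iff (pow_ne_zero _ hp.out.ne_zero) |>.mp h0
  -- (3) dimensions: `cdim_e ≤ d ≤ cdim_{e+m} ≤ cdim_e`
  have hmu : ∀ m, LinearIndependent k fun l => frobVec k p m (lam l) := fun m => linearIndependent_frobVec k p m lam hlam
  have hcd : ∀ m, cdim k p 𝔮 (e + m) = d := by
    intro m
    have h1 := cdim_add_finrank_pointForms k p 𝔮 e
    have h2 := cdim_add_finrank_pointForms k p 𝔮 (e + m)
    haveI : FiniteDimensional k (pointForms k p 𝔮 e) := FiniteDimensional.finiteDimensional_submodule _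
    have hlowd : Module.finrank k N ≤ Module.finrank k (pointForms k p 𝔮 e) := Submodule.finrank_mono hlow
    have hupd : Module.finrank k (pointForms k p 𝔮 (e + m)) ≤ n + 1 - d := by
      rw [← finrank_ker_mulVecLin_of_linearIndependent k _ (hmu m)]
      exact Submodule.finrank_mono (hup m)
    have hanti := cdim_add_le k p 𝔮 e m
    omega
  refine exponentLE_of_cdim_eq k p 𝔮 e fun m => ?_
  rw [hcd m, ← hcd 0]
  rfl

/-- **The `q`-linear generization of ANY point has exponent `≤ e`** (no hypothesis on the exponent of `𝔭`).
[cite: Oda1983HironakaGroupSchemeII, Cor. 2.3 (p. 1171)] -/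
theorem exponentLE_frobGen (𝔭 : Ideal (MvPolynomial (Fin (n + 1)) k)) : ExponentLE k p (frobGen k p 𝔭 e) e := by
  unfold frobGen linHullIdeal
  exact exponentLE_comap_span_linForm k p (pointForms k p 𝔭 e) e

/-- `exponent B(𝔮_e(𝔭)) ≤ e`. [cite: Oda1983HironakaGroupSchemeII, Cor. 2.3 (p. 1171)] -/
theorem exponent_frobGen_le (𝔭 : Ideal (MvPolynomial (Fin (n + 1)) k)) : exponent k p (frobGen k p 𝔭 e) ≤ e :=
  (exponent_le_iff k p _).mpr (exponentLE_frobGen k p e 𝔭)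

variable {N e}

/-- Points with the same Hironaka scheme have the same `ExponentLE` (the scheme determines `U(𝔭) ∩ L = (L_B)`).
[cite: Mizutani1973HironakaGroupSchemes, §1 (c) (the exponent of B is that of U(𝔭) ∩ L)] -/
theorem exponentLE_of_bIdeal_eq {𝔭 𝔶 : Ideal (MvPolynomial (Fin (n + 1)) k)} [𝔭.IsPrime] [𝔶.IsPrime]
    (hP : IsPoint k 𝔭) (hY : IsPoint k 𝔶) (h : bIdeal k 𝔶 = bIdeal k 𝔭) {e' : ℕ} (hE : ExponentLE k p 𝔶 e') :
    ExponentLE k p 𝔭 e' := by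
  have hinv : ∀ j, invForms k p 𝔶 j = invForms k p 𝔭 j := by
    intro j
    ext a
    rw [← hirForms_eq_invForms 𝔶 j, ← hirForms_eq_invForms 𝔭 j, ← addForm_mem_bIdeal_iff k p 𝔶 hY,
      ← addForm_mem_bIdeal_iff k p 𝔭 hP, h]
  intro j hj
  rw [← hinv j, ← hinv e', hE j hj]

/-- **ODA'S COR. 2.3 FOR POINTS, BOTH DIRECTIONS**: for a point `𝔭` of `ℙ^n_k` and any `e`,
`exponent B(𝔭) ≤ e ↔ U_+(𝔮_e(𝔭))S = U_+(𝔭)S` — the Hironaka scheme of `𝔭` is that of its `q`-linear generization.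
[cite: Oda1983HironakaGroupSchemeII, Cor. 2.3 (p. 1171: "exponent(B) ≤ e iff the corresponding V is defined over F^{-e}(k)")] -/
theorem exponent_le_iff_bIdeal_frobGen_eq (𝔭 : Ideal (MvPolynomial (Fin (n + 1)) k)) [𝔭.IsPrime] (hP : IsPoint k 𝔭)
    (e : ℕ) :
    exponent k p 𝔭 ≤ e ↔ (haveI := isPrime_frobGen k p 𝔭 e; bIdeal k (frobGen k p 𝔭 e)) = bIdeal k 𝔭 := by
  haveI := isPrime_frobGen k p 𝔭 e
  constructor
  · intro he
    exact bIdeal_frobGen_eq k p 𝔭 e hP ((exponent_le_iff k p 𝔭).mp he)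
  · intro h
    exact (exponent_le_iff k p 𝔭).mpr
      (exponentLE_of_bIdeal_eq k p hP (isPoint_frobGen k p 𝔭 e hP) h (exponentLE_frobGen k p e 𝔭))

/-- **`exponent B(𝔭) ≤ e` iff `B(𝔭)` is the Hironaka scheme of some `q`-LINEAR point** (`q = p^e`; a point of the form
`{f : f^{(F^e)} ∈ (Σ g_i X_i : g ∈ N)}` for a subspace `N` of linear forms) — Oda's «`V` defined over `F^{−e}(k)`» /
«`φ` over `F^{−e}(k)`» in the tree's vocabulary. [cite: Oda1983HironakaGroupSchemeII, Cor. 2.3 (p. 1171) and Thm. 3.1 (p. 1173)] -/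
theorem exponent_le_iff_exists_qLinear (𝔭 : Ideal (MvPolynomial (Fin (n + 1)) k)) [𝔭.IsPrime] (hP : IsPoint k 𝔭)
    (e : ℕ) :
    exponent k p 𝔭 ≤ e ↔ ∃ (N : Submodule k (Fin (n + 1) → k))
      (_ : ((Ideal.span (linForm '' (N : Set (Fin (n + 1) → k)))).comap (MvPolynomial.map (iterateFrobenius k p e))).IsPrime),
      IsPoint k ((Ideal.span (linForm '' (N : Set (Fin (n + 1) → k)))).comap (MvPolynomial.map (iterateFrobenius k p e))) ∧
      bIdeal k ((Ideal.span (linForm '' (N : Set (Fin (n + 1) → k)))).comap (MvPolynomial.map (iterateFrobenius k p e))) =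
        bIdeal k 𝔭 := by
  constructor
  · intro he
    refine ⟨pointForms k p 𝔭 e, isPrime_frobGen k p 𝔭 e, isPoint_frobGen k p 𝔭 e hP, ?_⟩
    exact bIdeal_frobGen_eq k p 𝔭 e hP ((exponent_le_iff k p 𝔭).mp he)
  · rintro ⟨N, hprime, hpt, h⟩
    exact (exponent_le_iff k p 𝔭).mpr
      (exponentLE_of_bIdeal_eq k p hP hpt h (exponentLE_comap_span_linForm k p N e))

end QLinear

end Summit.ResolutionOfSingularities.KangarooAtlas.Mizutani

end
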